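import Summits.BirchSwinnertonDyer.BirchSwinnertonDyer.Theorems.PrintCf2SplitBadTwoLevelEigenSplitting
import Summits.BirchSwinnertonDyer.BirchSwinnertonDyer.Theorems.PrintCf2SplitBadTwoLevelKernelLocal
import HarnessLib

/-!
# Crux `PrintCf2.SplitBadTwoRankOneOfFacts` (stmt-BirchSwinnertonDyer-20368), road α v10.3, S3c residual (R-TOP) = brick B17, towards (LS):
# THE POITOU–TATE OBSTRUCTION VANISHES FOR `W*`-FAMILIES — X11b's `sum_localTatePairingZMod_liftFamily_eq_zero` WITHOUT «`E[p^∞]^{Γ_K} = 0`»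

Cell `bsd-print-cf2`, EXTRA WIDTH seat `bsd-line-cf2-p1-w4` g9 (prover-bsd-line-cf2-p1-w4-g9-0); `--supports stmt-BirchSwinnertonDyer-20368`
(helper, Theses-free). HONEST FRAMING: nothing here closes the crux or a registered stub; BSD is not proved by any of this; no summit statement
is proved by this seat. No definition, no named fact, no `sorry`. Local Tate duality / Poitou–Tate enter through the DATA `inv` (`IsPerfect`,
`UnramifiedOrthogonal`) exactly as in X11b (supplied by the cited fact `poitouTate_selmerStructure_duality K` in the consumer).

WHAT (TURNKEY-20368-LS-w4g9.md §2(c)). JSW17 Prop. 3.3.2's obstruction `∑_{v ∈ T} ⟨t_v, y_v⟩_v` for the test family `t = liftFamily s` at level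
`N = K₀ + e` and `y ∈ H¹_{𝓕*}(K, E[p^N]^D)`, `𝓕 = lowerStructure W p N 𝔭 Σ T`. X11b kills `H¹(π) ỹ` (`ỹ = H¹(w⁻¹) y`) by injectivity of
`H¹(ι_{K₀})` (hypothesis «no invariants», false for the CM members at `p = 2`). Here the family consists of `E[𝔮^∞]`-CLASSES (`s_v = H¹(ẽ_{K₀}) s_v`
for a level eigen-projector, file 4 p669287), and:
 * the `ẽ_N`-component of `ỹ_v` pairs to zero with `t_v = H¹(ẽ_N)(H¹(ι) s_v)` by ISOTROPY (p669287 `cupProduct_map_levelProj_eq_zero`; `W*[p^N]` cyclic,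
   Weil pairing alternating);
 * the complementary component `z = H¹(ẽ′_N) ỹ`: `H¹(ι_N) z = H¹(j′)(H¹(ι_N) ỹ)` lies in the image under the `E[𝔮̄^∞]`-projector `j′ = ι′ e′` of
   Castella's RELAXED CONJUGATE group (X11b `map_weilTransport_mem_selmerGroup_acStructure`), which `p^e` kills BY HYPOTHESIS (`he'` — the
   finiteness of `𝔖_v^R(K, W*′)`, hfinB′ of p667090, in the consumer); so `H¹(ι_{K₀})(H¹(π) z) = p^e H¹(ι_N) z = 0`; and `loc_𝔮 z = 0` because
   `𝓕_𝔮 = ⊤` at the relaxed place `𝔮` (dual `⊥`); hence `H¹(π) z = 0` by p669646 `map_levelMul_eq_zero_of_localization_eq_zero` once `p^{K₀}` kills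
   `E[p^∞]^{Γ_{K_𝔮}}` (hypothesis `hK₀`: choose `K₀` large, local torsion is finite) — and then X11b's `cupProduct_restrict_weil_map_levelIncl_eq_zero`.
**`sum_localTatePairingZMod_liftFamily_eq_zero_of_proj`**: the obstruction vanishes. Consumer (next file): `levelLiftingP` for `W*`-families ⟹ (LS).
presearch: JSW17 Prop. 3.3.2 (arXiv:1512.06894 p. 11); Milne ADT I §6 proof of Prop. 6.9; Greenberg LNM 1716 §4 remark after Prop. 4.13; no new fact.
beyond-print theorem: no.

References: [JetchevSkinnerWan2017] Prop. 3.3.2; [MilneADT2006] I §2, §6; [GreenbergLNM1716] §4; [Howard2004HeegnerKolyvagin] Thm. 2.1.11.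
-/

noncomputable section

open scoped Classical

set_option linter.dupNamespace false
set_option autoImplicit false

open CategoryTheory Field NumberField IsDedekindDomain
open Literature.NumberTheory.EllipticCurves Literature.NumberTheory.EllipticCurves.GreenbergSelmer
open Literature.NumberTheory.GaloisRepresentations
open Literature.NumberTheory.GaloisRepresentations.DiscreteGaloisModule (SelmerStructure TateDual tateDual
  localTatePairingZMod unramifiedSubgroup)
open Literature.NumberTheory.GaloisCohomology
open scoped ContRepresentation
open Summit.BirchSwinnertonDyer.Rank1Residual.X11b
open Summit.BirchSwinnertonDyer.Rank1Residual.X11b.LocBridge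
open Summit.BirchSwinnertonDyer.Rank1Residual.X11b.Levels
open Summit.BirchSwinnertonDyer.Rank1Residual.X11b.AcSelmer

namespace Summit.BirchSwinnertonDyer.BirchSwinnertonDyer.Theorems.PrintCf2.LevelEigen

variable {K : Type} [Field K] [NumberField K] (W : WeierstrassCurve K) [W.IsElliptic] (p : ℕ)
  [Fact p.Prime] (𝔭 : HeightOneSpectrum (𝓞 K)) {S : Set (HeightOneSpectrum (𝓞 K))}
  (T : Finset (Place K)) (K₀ e : ℕ)

/-- **The Poitou–Tate obstruction of JSW17 Prop. 3.3.2 VANISHES for `E[𝔮^∞]`-families, without «`E[p^∞]^{Γ_K} = 0`».** Setting of X11b's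
`sum_localTatePairingZMod_liftFamily_eq_zero` (`t = liftFamily s`, `N = K₀ + e`, `𝓕 = lowerStructure`, `y ∈ H¹_{𝓕*}(K, E[p^N]^D)`, perfect
`inv` with Milne I.2.6), PLUS: level eigen-projectors `eK` (level `K₀`) and `eN`, `eN'` (level `N`, `eN + eN' = id`), the family consists of
`eK`-classes (`hs`), `ι ∘ eK = eN ∘ ι` (`hc1`), `eN` has values in a cyclic group (`hcyc`, isotropy), `ι_N ∘ eN' = j' ∘ ι_N` for an endomorphism
`j'` of `E[p^∞]` (`hc3`), `p^e` kills `H¹(j')` of the relaxed conjugate group (`he'`), and `p^{K₀}` kills `E[p^∞]^{Γ_{K_𝔮}}` (`hK₀`). Then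
`∑_{v ∈ T} ⟨t_v, loc_v y⟩_v = 0`. [cite: JetchevSkinnerWan2017, Prop. 3.3.2 (arXiv:1512.06894 p. 11)] [cite: MilneADT2006, Ch. I §6, proof of Prop. 6.9]
[cite: GreenbergLNM1716, §4 remark after Prop. 4.13] -/
theorem sum_localTatePairingZMod_liftFamily_eq_zero_of_proj [NeZero (p ^ (K₀ + e))] [Finite (W.geomTorsion ((p ^ (K₀ + e) : ℕ) : ℤ))]
    (hK : ∀ w : InfinitePlace K, w.IsComplex)
    {𝔮 : HeightOneSpectrum (𝓞 K)} (h𝔮 : ((p : ℕ) : 𝓞 K) ∈ 𝔮.asIdeal) (hne : 𝔮 ≠ 𝔭)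
    (hSig : ∀ v ∈ S, (Sum.inr v : Place K) ∈ T)
    (hbad : ∀ v : HeightOneSpectrum (𝓞 K), ¬ W.HasGoodReductionAt v → (Sum.inr v : Place K) ∈ T)
    (he1 : 1 ≤ e)
    -- the level eigen-projectors and their compatibilities
    (eK : (W.torsionGaloisModule ((p ^ K₀ : ℕ) : ℤ)).toContRepresentation →ⁱL
      (W.torsionGaloisModule ((p ^ K₀ : ℕ) : ℤ)).toContRepresentation)
    (eN eN' : (W.torsionGaloisModule ((p ^ (K₀ + e) : ℕ) : ℤ)).toContRepresentation →ⁱL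
      (W.torsionGaloisModule ((p ^ (K₀ + e) : ℕ) : ℤ)).toContRepresentation)
    (hsum : ∀ x, eN x + eN' x = x)
    (hc1 : ∀ x, levelIncl W p K₀ e (eK x) = eN (levelIncl W p K₀ e x))
    (hcyc : ∃ g : W.geomTorsion ((p ^ (K₀ + e) : ℕ) : ℤ), ∀ x, ∃ a : ℤ, eN x = a • g)
    (j' : (primaryGaloisModule W p).toContRepresentation →ⁱL (primaryGaloisModule W p).toContRepresentation)
    (hc3 : ∀ x, primaryInclusion W p (K₀ + e) (eN' x) = j' (primaryInclusion W p (K₀ + e) x))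
    (he' : ∀ x ∈ (acStructure (primaryGaloisModule W p) p 𝔮
      {v | (Sum.inr v : Place K) ∈ T ∧ ((p : ℕ) : 𝓞 K) ∉ v.asIdeal}).selmerGroup, p ^ e • galoisCohomology.map j' 1 x = 0)
    (hK₀ : ∀ Q : W.geomPrimaryTorsion p,
      (∀ σ : absoluteGaloisGroup (𝔮.adicCompletion K),
        GaloisRep.restrictField (𝔮.adicCompletion K) (primaryGaloisModule W p) σ Q = Q) → p ^ K₀ • Q = 0)
    {inv : LocalInvariants K (p ^ (K₀ + e))} (hperf : inv.IsPerfect) (hur : inv.UnramifiedOrthogonal)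
    (s : ∀ v : S, galoisCohomology (GaloisRep.restrictField
      (Place.Completion (Sum.inr (v : HeightOneSpectrum (𝓞 K)) : Place K))
      (W.torsionGaloisModule ((p ^ K₀ : ℕ) : ℤ))) 1)
    (hs : ∀ v : S, galoisCohomology.map (eK.restrictField
      (Place.Completion (Sum.inr (v : HeightOneSpectrum (𝓞 K)) : Place K))) 1 (s v) = s v)
    {y : galoisCohomology ((W.torsionGaloisModule ((p ^ (K₀ + e) : ℕ) : ℤ)).tateDual (p ^ (K₀ + e))) 1}
    (hy : y ∈ (inv.dualSelmerStructure (W.torsionGaloisModule ((p ^ (K₀ + e) : ℕ) : ℤ))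
        (lowerStructure W p (K₀ + e) 𝔭 S T)).selmerGroup) :
    ∑ v ∈ T, localTatePairingZMod (W.torsionGaloisModule ((p ^ (K₀ + e) : ℕ) : ℤ)) (p ^ (K₀ + e)) v
        (inv v) (liftFamily W p K₀ e s v)
        (galoisCohomology.localization
          ((W.torsionGaloisModule ((p ^ (K₀ + e) : ℕ) : ℤ)).tateDual (p ^ (K₀ + e))) v 1 y) = 0 := by
  have hprime : p.Prime := Fact.out
  haveI : NeZero (p ^ K₀) := Levels.neZero_pow p K₀
  haveI : Finite (W.geomTorsion ((p ^ K₀ : ℕ) : ℤ)) := finite_geomTorsion_pow W p K₀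
  haveI : CompactSpace (absoluteGaloisGroup K) := absoluteGaloisGroup_compactSpace K
  have hdiv : W.zsmul_geomPoints_surjective := W.zsmul_geomPoints_surjective_holds
  -- a Weil pairing on `E[p^N]`, `N = K₀ + e ≥ 1`
  have hp2 : 2 ≤ p ^ (K₀ + e) := le_trans hprime.two_le (Nat.le_self_pow (by omega) p)
  have hchar : ((p ^ (K₀ + e) : ℕ) : K) ≠ 0 := Nat.cast_ne_zero.mpr (pow_ne_zero _ hprime.ne_zero)
  obtain ⟨ε, hμ, hadd₁, hadd₂, halt, hnondeg, hgal⟩ := W.exists_weilPairing_holds (p ^ (K₀ + e)) hp2 hchar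
  set yW := galoisCohomology.map (weilDualInv W (p ^ (K₀ + e)) ε hμ hadd₁ hadd₂ hgal hnondeg) 1 y
    with hyWdef
  have hyW : galoisCohomology.map (weilDualIntertwining W (p ^ (K₀ + e)) ε hμ hadd₁ hadd₂ hgal) 1 yW = y :=
    map_weilDual_map_weilDualInv W (p ^ (K₀ + e)) ε hμ hadd₁ hadd₂ hgal hnondeg y
  have hMn : ∀ m : W.geomTorsion ((p ^ (K₀ + e) : ℕ) : ℤ), (p ^ (K₀ + e)) • m = 0 := fun m ↦
    AddSubgroup.torsionBy.nsmul m
  -- isotropy on the `eN`-component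
  obtain ⟨g, hg⟩ := hcyc
  have hiso : ∀ x z, weilPairingHom W (p ^ (K₀ + e)) ε hμ hadd₁ hadd₂ (eN x) (eN z) = 0 :=
    weilPairingHom_apply_apply_eq_zero_of_cyclic W (p ^ (K₀ + e)) ε hμ hadd₁ hadd₂ halt eN hg
  -- `H¹(ι_N) ỹ` lies in the relaxed conjugate group
  have hcmem := map_weilTransport_mem_selmerGroup_acStructure W p 𝔭 T ε hμ hadd₁ hadd₂ hgal hnondeg
    hK h𝔮 hne hSig hbad hperf hur hy
  -- the complementary component `z = H¹(eN') ỹ` is killed by `H¹(π)`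
  set z := galoisCohomology.map eN' 1 yW with hzdef
  have hιz : galoisCohomology.map (primaryInclusion W p (K₀ + e)) 1 z =
      galoisCohomology.map j' 1 (galoisCohomology.map (primaryInclusion W p (K₀ + e)) 1 yW) := by
    obtain ⟨ψ, hψ⟩ := oneCocycleClass_surjective _ yW
    rw [hzdef, ← hψ, galoisCohomology.map_one_oneCocycleClass, galoisCohomology.map_one_oneCocycleClass,
      galoisCohomology.map_one_oneCocycleClass, galoisCohomology.map_one_oneCocycleClass]
    congr 1
    refine Subtype.ext (ContinuousMap.ext fun σ ↦ ?_)
    exact hc3 (ψ.1 σ)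
  have hπz : galoisCohomology.map (levelMul W p K₀ e) 1 z = 0 := by
    refine map_levelMul_eq_zero_of_localization_eq_zero W p K₀ e z 𝔮 ?_ ?_ hK₀
    · -- (a) `H¹(ι_{K₀})(H¹(π) z) = p^e · H¹(ι_N) z = p^e · H¹(j')(H¹(ι_N) ỹ) = 0`
      rw [map_primaryInclusion_map_levelMul, hιz]
      exact he' _ hcmem
    · -- (b) `loc_𝔮 z = H¹(eN')(loc_𝔮 ỹ) = 0`: `𝓕_𝔮 = ⊤`, so `𝓕*_𝔮 = ⊥`, so `loc_𝔮 y = 0`, so `loc_𝔮 ỹ = 0`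
      have hy' := hy
      rw [SelmerStructure.mem_selmerGroup_iff] at hy'
      have h𝓕 : lowerStructure W p (K₀ + e) 𝔭 S T (Sum.inr 𝔮) = ⊤ := by
        rw [lowerStructure_inr_of_not W p (K₀ + e) 𝔭 S T (fun h ↦ h.2 h𝔮)]
        exact acLevelStructure_eq_top_of_mem_of_ne W p (K₀ + e) 𝔭 S h𝔮 hne
      have hyv := hy' (Sum.inr 𝔮)
      rw [LocalInvariants.dualSelmerStructure_apply, h𝓕,
        PoitouTateCounting.dualLocalCondition_top hperf (W.torsionGaloisModule ((p ^ (K₀ + e) : ℕ) : ℤ)) hMn 𝔮,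
        AddSubgroup.mem_bot, ← hyW, localization_map_one] at hyv
      have hyWv : galoisCohomology.localization (W.torsionGaloisModule ((p ^ (K₀ + e) : ℕ) : ℤ)) (Sum.inr 𝔮) 1 yW = 0 :=
        map_weilDual_restrictField_injective W (p ^ (K₀ + e)) ε hμ hadd₁ hadd₂ hgal hnondeg _
          (hyv.trans (map_zero _).symm)
      rw [hzdef, localization_map_one, hyWv]
      exact map_zero _
  refine Finset.sum_eq_zero fun v _ ↦ ?_
  rcases v with w | v
  · rw [liftFamily_inl, map_zero, AddMonoidHom.zero_apply]
  · by_cases hvS : v ∈ S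
    · haveI : CompactSpace (absoluteGaloisGroup (Place.Completion (Sum.inr v : Place K))) := absoluteGaloisGroup_compactSpace _
      -- the splitting `loc_v ỹ = H¹(eN) loc_v ỹ + H¹(eN') loc_v ỹ`
      have hsplit := map_restrictField_add_map_restrictField_eq W p (K₀ + e) (Place.Completion (Sum.inr v : Place K)) eN eN' hsum
        (galoisCohomology.localization (W.torsionGaloisModule ((p ^ (K₀ + e) : ℕ) : ℤ)) (Sum.inr v) 1 yW)
      -- term A: isotropy
      have hsv : galoisCohomology.map ((levelIncl W p K₀ e).restrictField (Place.Completion (Sum.inr v : Place K))) 1 (s ⟨v, hvS⟩) =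
          galoisCohomology.map (eN.restrictField (Place.Completion (Sum.inr v : Place K))) 1
            (galoisCohomology.map ((levelIncl W p K₀ e).restrictField (Place.Completion (Sum.inr v : Place K))) 1 (s ⟨v, hvS⟩)) := by
        conv_lhs => rw [← hs ⟨v, hvS⟩]
        obtain ⟨φ, hφ⟩ := oneCocycleClass_surjective _ (s ⟨v, hvS⟩)
        rw [← hφ, galoisCohomology.map_one_oneCocycleClass, galoisCohomology.map_one_oneCocycleClass,
          galoisCohomology.map_one_oneCocycleClass, galoisCohomology.map_one_oneCocycleClass]
        congr 1
        refine Subtype.ext (ContinuousMap.ext fun σ ↦ ?_)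
        exact hc1 (φ.1 σ)
      have hA : ((weilContPairing W (p ^ (K₀ + e)) ε hμ hadd₁ hadd₂ hgal).restrict
            (absGaloisRestrict K (Place.Completion (Sum.inr v : Place K)))).cupProduct
          (galoisCohomology.map ((levelIncl W p K₀ e).restrictField (Place.Completion (Sum.inr v : Place K))) 1 (s ⟨v, hvS⟩))
          (galoisCohomology.map (eN.restrictField (Place.Completion (Sum.inr v : Place K))) 1
            (galoisCohomology.localization (W.torsionGaloisModule ((p ^ (K₀ + e) : ℕ) : ℤ)) (Sum.inr v) 1 yW)) = 0 := by
        rw [hsv]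
        exact cupProduct_map_levelProj_eq_zero W (p ^ (K₀ + e)) ε hμ hadd₁ hadd₂ hgal (Place.Completion (Sum.inr v : Place K))
          eN hiso _ _
      -- term B: the complementary component dies under `H¹(π)`
      have hπv : galoisCohomology.map ((levelMul W p K₀ e).restrictField (Place.Completion (Sum.inr v : Place K))) 1
          (galoisCohomology.localization (W.torsionGaloisModule ((p ^ (K₀ + e) : ℕ) : ℤ)) (Sum.inr v) 1 z) = 0 := by
        rw [← localization_map_one, hπz]
        exact map_zero _
      have hz' : galoisCohomology.map (eN'.restrictField (Place.Completion (Sum.inr v : Place K))) 1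
          (galoisCohomology.localization (W.torsionGaloisModule ((p ^ (K₀ + e) : ℕ) : ℤ)) (Sum.inr v) 1 yW) =
          galoisCohomology.localization (W.torsionGaloisModule ((p ^ (K₀ + e) : ℕ) : ℤ)) (Sum.inr v) 1 z := by
        rw [hzdef]
        exact (localization_map_one eN' (Sum.inr v) yW).symm
      have hB : ((weilContPairing W (p ^ (K₀ + e)) ε hμ hadd₁ hadd₂ hgal).restrict
            (absGaloisRestrict K (Place.Completion (Sum.inr v : Place K)))).cupProduct
          (galoisCohomology.map ((levelIncl W p K₀ e).restrictField (Place.Completion (Sum.inr v : Place K))) 1 (s ⟨v, hvS⟩))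
          (galoisCohomology.map (eN'.restrictField (Place.Completion (Sum.inr v : Place K))) 1
            (galoisCohomology.localization (W.torsionGaloisModule ((p ^ (K₀ + e) : ℕ) : ℤ)) (Sum.inr v) 1 yW)) = 0 := by
        rw [hz']
        exact cupProduct_restrict_weil_map_levelIncl_eq_zero W p K₀ e hdiv ε hμ hadd₁ hadd₂ hgal (Place.Completion (Sum.inr v : Place K))
          (s ⟨v, hvS⟩) hπv
      have key : ((weilContPairing W (p ^ (K₀ + e)) ε hμ hadd₁ hadd₂ hgal).restrict
            (absGaloisRestrict K (Place.Completion (Sum.inr v : Place K)))).cupProduct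
          (galoisCohomology.map ((levelIncl W p K₀ e).restrictField (Place.Completion (Sum.inr v : Place K))) 1 (s ⟨v, hvS⟩))
          (galoisCohomology.localization (W.torsionGaloisModule ((p ^ (K₀ + e) : ℕ) : ℤ)) (Sum.inr v) 1 yW) = 0 := by
        have h := ((((weilContPairing W (p ^ (K₀ + e)) ε hμ hadd₁ hadd₂ hgal).restrict
            (absGaloisRestrict K (Place.Completion (Sum.inr v : Place K)))).cupProduct
          (galoisCohomology.map ((levelIncl W p K₀ e).restrictField (Place.Completion (Sum.inr v : Place K))) 1 (s ⟨v, hvS⟩)))).map_add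
          (galoisCohomology.map (eN.restrictField (Place.Completion (Sum.inr v : Place K))) 1
            (galoisCohomology.localization (W.torsionGaloisModule ((p ^ (K₀ + e) : ℕ) : ℤ)) (Sum.inr v) 1 yW))
          (galoisCohomology.map (eN'.restrictField (Place.Completion (Sum.inr v : Place K))) 1
            (galoisCohomology.localization (W.torsionGaloisModule ((p ^ (K₀ + e) : ℕ) : ℤ)) (Sum.inr v) 1 yW))
        rw [hA, hB, add_zero] at h
        calc _ = _ := congrArg _ hsplit.symm
          _ = 0 := h
      rw [liftFamily_inr_of_mem W p K₀ e s hvS, ← hyW, localization_map_one,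
        localTatePairingZMod_map_weilDual, weilContPairingLocal_cupProduct_eq_restrict, key]
      exact map_zero _
    · rw [liftFamily_inr_of_not_mem W p K₀ e s hvS, map_zero, AddMonoidHom.zero_apply]

end Summit.BirchSwinnertonDyer.BirchSwinnertonDyer.Theorems.PrintCf2.LevelEigen

end
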